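import Literature.Computability.Complexity.DecisionTree
import HarnessLib

/-!
# The set of coordinates queried by a decision tree on an input

Topic `Literature/Computability/Complexity`, companion to `DecisionTree.lean` (Buhrman–de Wolf 2002, §2.1).  For a
deterministic Boolean decision tree `T` on `n` bits and an input `x`, `T.queries x` is the set of coordinates read along
the root-to-leaf path followed by `x`.  This is the object behind the quantities `δᵢ(T) = Pr_x[i ∈ T.queries x]` of the
OSSS inequality and the path sums of the O'Donnell–Servedio inequality (O'Donnell 2014, §8.6), which the tree so far
could only express through `cost` (the number of queries) or in `∃`-form.

* `DecisionTree.queries` and its equations `queries_leaf`, `queries_query`;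
* `card_queries_le_cost`, `card_queries_le_depth` — at most `cost ≤ depth` distinct coordinates are read;
* `queries_eq_of_agree` — an input agreeing with `x` on `T.queries x` has the same query set, output and cost;
* `eval_update_of_not_mem_queries` — flipping an unqueried coordinate does not change the output;
* `mem_queries_update_iff` — whether `i` is queried does not depend on the value of `x i`.

## References
* H. Buhrman, R. de Wolf, *Complexity measures and decision tree complexity: a survey*, Theoret. Comput. Sci. 288 (2002), §2.1.
* R. O'Donnell, *Analysis of Boolean Functions*, Cambridge University Press 2014, §8.6.
-/

namespace Literature.Computability.Complexity

namespace DecisionTree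

variable {n : ℕ}

/-- The set of coordinates queried by the decision tree `T` on the input `x`: the variables read along the root-to-leaf
path that `x` follows (a leaf reads nothing; a node reading `i` contributes `i` and then the queries of the branch selected
by `x i`). (Buhrman–de Wolf 2002, §2.1.) [cite: Wolf2002, §2.1] -/
def queries (x : Fin n → Bool) : DecisionTree n → Finset (Fin n)
  | leaf _ => ∅
  | query i t₀ t₁ => insert i (if x i then t₁.queries x else t₀.queries x)

/-- A leaf queries nothing. (Buhrman–de Wolf 2002, §2.1.) [cite: Wolf2002, §2.1] -/
@[simp] theorem queries_leaf (x : Fin n → Bool) (b : Bool) : (leaf b : DecisionTree n).queries x = ∅ := rfl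

/-- A query node reads its coordinate and then whatever the selected branch reads.
(Buhrman–de Wolf 2002, §2.1.) [cite: Wolf2002, §2.1] -/
@[simp] theorem queries_query (x : Fin n → Bool) (i : Fin n) (t₀ t₁ : DecisionTree n) :
    (query i t₀ t₁).queries x = insert i (if x i then t₁.queries x else t₀.queries x) := rfl

/-- At most `cost` distinct coordinates are read on any input. (Buhrman–de Wolf 2002, §2.1.) [cite: Wolf2002, §2.1] -/
theorem card_queries_le_cost (T : DecisionTree n) (x : Fin n → Bool) : (T.queries x).card ≤ T.cost x := by
  induction T with
  | leaf b => simp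
  | query i t₀ t₁ ih₀ ih₁ =>
    rw [queries_query, cost_query]
    refine (Finset.card_insert_le _ _).trans ?_
    rcases Bool.eq_false_or_eq_true (x i) with hx | hx
    · rw [hx, if_pos rfl, if_pos rfl]
      exact Nat.add_le_add_right ih₁ 1
    · rw [hx, if_neg Bool.false_ne_true, if_neg Bool.false_ne_true]
      exact Nat.add_le_add_right ih₀ 1

/-- At most `depth` distinct coordinates are read on any input. (Buhrman–de Wolf 2002, §2.1.) [cite: Wolf2002, §2.1] -/
theorem card_queries_le_depth (T : DecisionTree n) (x : Fin n → Bool) : (T.queries x).card ≤ T.depth :=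
  (card_queries_le_cost T x).trans (cost_le_depth T x)

/-- **The path is determined by the queried bits.** If `y` agrees with `x` on every coordinate that `T` queries on `x`,
then `T` follows the same path on `y`: same query set, same output, same cost (Buhrman–de Wolf 2002, §2.1: the
path, hence the leaf, is a function of the queried bits). [cite: Wolf2002, §2.1] -/
theorem queries_eq_of_agree (T : DecisionTree n) {x y : Fin n → Bool} (h : ∀ i ∈ T.queries x, y i = x i) :
    T.queries y = T.queries x ∧ T.eval y = T.eval x ∧ T.cost y = T.cost x := by
  induction T with
  | leaf b => simp
  | query i t₀ t₁ ih₀ ih₁ =>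
    have hi : y i = x i := h i (by rw [queries_query]; exact Finset.mem_insert_self _ _)
    rw [queries_query, queries_query, eval_query, eval_query, cost_query, cost_query, hi]
    rcases Bool.eq_false_or_eq_true (x i) with hx | hx
    · have h' : ∀ j ∈ t₁.queries x, y j = x j := fun j hj =>
        h j (by rw [queries_query, hx, if_pos rfl]; exact Finset.mem_insert_of_mem hj)
      obtain ⟨hq, he, hc⟩ := ih₁ h'
      rw [hx, if_pos rfl, if_pos rfl, if_pos rfl, if_pos rfl, if_pos rfl, if_pos rfl, hq, he, hc]
      exact ⟨rfl, rfl, rfl⟩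
    · have h' : ∀ j ∈ t₀.queries x, y j = x j := fun j hj =>
        h j (by rw [queries_query, hx, if_neg Bool.false_ne_true]; exact Finset.mem_insert_of_mem hj)
      obtain ⟨hq, he, hc⟩ := ih₀ h'
      rw [hx, if_neg Bool.false_ne_true, if_neg Bool.false_ne_true, if_neg Bool.false_ne_true,
        if_neg Bool.false_ne_true, if_neg Bool.false_ne_true, if_neg Bool.false_ne_true, hq, he, hc]
      exact ⟨rfl, rfl, rfl⟩

/-- Changing an unqueried coordinate changes neither the query set, nor the output, nor the cost.
(Buhrman–de Wolf 2002, §2.1.) [cite: Wolf2002, §2.1] -/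
theorem queries_update_of_not_mem (T : DecisionTree n) (x : Fin n → Bool) {i : Fin n} (hi : i ∉ T.queries x)
    (b : Bool) :
    T.queries (Function.update x i b) = T.queries x ∧ T.eval (Function.update x i b) = T.eval x ∧
      T.cost (Function.update x i b) = T.cost x :=
  queries_eq_of_agree T fun _ hj => Function.update_of_ne (ne_of_mem_of_not_mem hj hi) b x

/-- Flipping an unqueried coordinate does not change the output. (Buhrman–de Wolf 2002, §2.1.) [cite: Wolf2002, §2.1] -/
theorem eval_update_of_not_mem_queries (T : DecisionTree n) (x : Fin n → Bool) {i : Fin n}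
    (hi : i ∉ T.queries x) (b : Bool) : T.eval (Function.update x i b) = T.eval x :=
  (queries_update_of_not_mem T x hi b).2.1

/-- **Whether `i` is queried does not depend on the value of `x i`** (the decision to read `i` is taken before `x i` is
seen). (Buhrman–de Wolf 2002, §2.1.) [cite: Wolf2002, §2.1] -/
theorem mem_queries_update_iff (T : DecisionTree n) (x : Fin n → Bool) (i : Fin n) (b : Bool) :
    i ∈ T.queries (Function.update x i b) ↔ i ∈ T.queries x := by
  induction T with
  | leaf c => simp
  | query k t₀ t₁ ih₀ ih₁ =>
    by_cases hk : k = i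
    · subst hk
      simp
    · rw [queries_query, queries_query, Function.update_of_ne hk]
      rcases Bool.eq_false_or_eq_true (x k) with hx | hx
      · rw [hx, if_pos rfl, if_pos rfl, Finset.mem_insert, Finset.mem_insert, ih₁]
      · rw [hx, if_neg Bool.false_ne_true, if_neg Bool.false_ne_true, Finset.mem_insert, Finset.mem_insert, ih₀]

end DecisionTree

end Literature.Computability.Complexity
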